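import Summits.AnomalousDissipation.AnomalousDissipation.Theorems.SawtoothPulseCascadeK1LocalisedCascadeOscJunkNumeric

/-!
# K1loc — helper: THE CTE-GEOM JUNK AMPLITUDES AGAINST RATIONAL CERTIFICATES (numeric layer, typed tools)

Helper file of the prover lane on the crux `K1LocalisedCascade` (stmt-AnomalousDissipation-19491), route `SawtoothPulseCascade`
(S-D seat, arbiter A24-6; companion of ad-k1loc-p2's `…OscJunkNumeric` for the corner-trace grade with aggregate tracked energy).
The window amplitude of `…PhaseWindowsCTE` / `…PhaseStepCTE.resolved_step_cte` is
  `w = √(A + β*/2) + √(ρ*/2 + Z)`, `A = a/π²`, `β* = b/π²` (`a, b ≥ 0` rational at every instance),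
  `ρ* = (π·ℓ·q·ε/N)²`, `Z = M_b·(8Mδ_j·r*/π)`;
against rational certificates decided by `norm_num` at each instance:
* `div_pi_sq_add_le` — `a/π² + b/π²/2 ≤ c` from `(a + b/2)/9.8696 ≤ c`;
* `round_zone_le` — `(πℓqε/N)²/2 + M_b(8Mδ·r*/π) ≤ c` from `(3.1416ℓqε/N)²/2 + M_b(8Mδ*·r*/3.141592) ≤ c` and `0 ≤ δ ≤ δ*`;
* `sqrt_add_sqrt_le_of_sq` — `√x₁ + √x₂ ≤ r₁ + r₂` from `x_i ≤ r_i²`;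
* `resolvedJunkW_le` — the increment of `resolved_step_cte`,
  `e = w_T² + 2w_T·o + (w_S + w_C + 𝔞 + √f_C)² + (w_O + w_C + 𝔞 + √f_C)² + f_S + f_T + f_O`, is monotone in the amplitudes:
  `w_X ≤ W_X`, `𝔞 ≤ α`, `√f_C ≤ ψ`, `f_X ≤ φ_X` give `e ≤ W_T² + 2W_T·o + (W_S + W_C + α + ψ)² + (W_O + W_C + α + ψ)² + φ_S + φ_T + φ_O`
  (the off-cone amplitude `o ≥ 0` stays symbolic); `offConeNextW_le` — the next off-cone amplitude.
The far terms are `…OscJunkNumeric.far_sq_le` / `sqrt_far_sq_le` unchanged (with `X = ⌊Λ₀9^{M_b}/8^{M_b}⌋` evaluated by `norm_num`);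
`N_j = 2^j` is `K1Ledger.N_cast_eq` (`…LedgerCutoffSchedule`).
Pure real arithmetic; no definitions; no statement about the crux. [cite: Grafakos2014, Prop. 3.2.7 (3)] [problem: turb]
-/

-- `Summit.<Summit>.<Problem>`: single-conjunct summit, the duplicate namespace segment is deliberate.
set_option linter.dupNamespace false

noncomputable section

namespace Summit.AnomalousDissipation.AnomalousDissipation.Theorems.SawtoothPulseCascade.K1Window

open Real
open Literature.Analysis.FluidPDE.SawtoothCascade Literature.Analysis.FluidPDE.SawtoothCascade.CascadeParams

/-! ## §1 π against decimals -/

/-- **The `1/π²` part of the CTE junk against a decimal**: `a, b ≥ 0` and `(a + b/2)/9.8696 ≤ c` give `a/π² + b/π²/2 ≤ c`.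
[folklore] -/
theorem div_pi_sq_add_le {a b c : ℝ} (ha : 0 ≤ a) (hb : 0 ≤ b) (h : (a + b / 2) / 9.8696 ≤ c) :
    a / π ^ 2 + b / π ^ 2 / 2 ≤ c := by
  have hπ : (9.8696 : ℝ) ≤ π ^ 2 := by
    have h := Real.pi_gt_d6
    nlinarith
  have e : a / π ^ 2 + b / π ^ 2 / 2 = (a + b / 2) / π ^ 2 := by ring
  rw [e]
  exact (div_le_div_of_nonneg_left (by positivity) (by norm_num) hπ).trans h

/-- **The rounding + zone part of the CTE junk against decimals**: `ℓ, q, ε, M, r* ≥ 0`, `N > 0`, `0 ≤ δ ≤ δ*` and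
`(3.1416·ℓ·q·ε/N)²/2 + M_b·(8Mδ*·r*/3.141592) ≤ c` give `(πℓqε/N)²/2 + M_b·(8Mδ·r*/π) ≤ c`. [folklore] -/
theorem round_zone_le {ℓ q ε N M δ δs rs c : ℝ} {Mb : ℕ} (hℓ : 0 ≤ ℓ) (hq : 0 ≤ q) (hε : 0 ≤ ε) (hN : 0 < N) (hM : 0 ≤ M)
    (hδ : 0 ≤ δ) (hδs : δ ≤ δs) (hrs : 0 ≤ rs)
    (h : (3.1416 * ℓ * q * ε / N) ^ 2 / 2 + Mb * (8 * M * δs / 3.141592 * rs) ≤ c) :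
    (π * ℓ * q * ε / N) ^ 2 / 2 + Mb * (8 * M * δ / π * rs) ≤ c := by
  have hπ1 := Real.pi_gt_d6
  have hπ2 := Real.pi_lt_d4
  have h1 : (π * ℓ * q * ε / N) ^ 2 ≤ (3.1416 * ℓ * q * ε / N) ^ 2 := by
    refine pow_le_pow_left₀ (by positivity) ?_ 2
    exact div_le_div_of_nonneg_right (mul_le_mul_of_nonneg_right (mul_le_mul_of_nonneg_right
      (mul_le_mul_of_nonneg_right hπ2.le hℓ) hq) hε) hN.le
  have h2 : 8 * M * δ / π * rs ≤ 8 * M * δs / 3.141592 * rs := by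
    refine mul_le_mul_of_nonneg_right ?_ hrs
    calc 8 * M * δ / π ≤ 8 * M * δs / π := div_le_div_of_nonneg_right (by nlinarith) Real.pi_pos.le
      _ ≤ 8 * M * δs / 3.141592 := by
          have hδs0 : 0 ≤ δs := hδ.trans hδs
          exact div_le_div_of_nonneg_left (by positivity) (by norm_num) hπ1.le
  have h3 : (Mb : ℝ) * (8 * M * δ / π * rs) ≤ Mb * (8 * M * δs / 3.141592 * rs) :=
    mul_le_mul_of_nonneg_left h2 (Nat.cast_nonneg _)
  linarith

/-- **Two square roots against two rationals**: `x₁ ≤ r₁²`, `x₂ ≤ r₂²`, `r₁, r₂ ≥ 0` give `√x₁ + √x₂ ≤ r₁ + r₂`. [folklore] -/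
theorem sqrt_add_sqrt_le_of_sq {x₁ x₂ r₁ r₂ : ℝ} (h1 : x₁ ≤ r₁ ^ 2) (h2 : x₂ ≤ r₂ ^ 2) (hr₁ : 0 ≤ r₁) (hr₂ : 0 ≤ r₂) :
    Real.sqrt x₁ + Real.sqrt x₂ ≤ r₁ + r₂ :=
  add_le_add ((Real.sqrt_le_sqrt h1).trans_eq (Real.sqrt_sq hr₁)) ((Real.sqrt_le_sqrt h2).trans_eq (Real.sqrt_sq hr₂))

/-! ## §2 The increment of one resolved phase against certified amplitudes -/

/-- **A squared feed window against certified amplitudes**: `0 ≤ w₁ ≤ W₁`, `0 ≤ w₂ ≤ W₂`, `0 ≤ 𝔞 ≤ α`, `√f ≤ ψ` give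
`(w₁ + w₂ + 𝔞 + √f)² ≤ (W₁ + W₂ + α + ψ)²`. [folklore] -/
theorem sq_window_amplitudeW_le {w₁ w₂ W₁ W₂ 𝔞 α f ψ : ℝ} (hw₁ : 0 ≤ w₁) (h₁ : w₁ ≤ W₁) (hw₂ : 0 ≤ w₂) (h₂ : w₂ ≤ W₂)
    (h𝔞0 : 0 ≤ 𝔞) (h𝔞 : 𝔞 ≤ α) (hf : Real.sqrt f ≤ ψ) :
    (w₁ + w₂ + 𝔞 + Real.sqrt f) ^ 2 ≤ (W₁ + W₂ + α + ψ) ^ 2 :=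
  pow_le_pow_left₀ (by positivity) (by linarith) 2

/-- **THE INCREMENT OF `resolved_step_cte` AGAINST CERTIFIED AMPLITUDES**: amplitudes `0 ≤ w_X ≤ W_X` (`X = T, S, C, O`),
cap `0 ≤ 𝔞 ≤ α`, far terms `√f_C ≤ ψ`, `f_S ≤ φ_S`, `f_T ≤ φ_T`, `f_O ≤ φ_O`, off-cone amplitude `o ≥ 0` (symbolic) give
`w_T² + 2w_T·o + (w_S + w_C + 𝔞 + √f_C)² + (w_O + w_C + 𝔞 + √f_C)² + f_S + f_T + f_O`
`≤ W_T² + 2W_T·o + (W_S + W_C + α + ψ)² + (W_O + W_C + α + ψ)² + φ_S + φ_T + φ_O`. [folklore] -/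
theorem resolvedJunkW_le {wT wS wC wO WT WS WC WO 𝔞 α fC fS fT fO o ψ φS φT φO : ℝ} (hwT : 0 ≤ wT) (hT : wT ≤ WT)
    (hwS : 0 ≤ wS) (hS : wS ≤ WS) (hwC : 0 ≤ wC) (hC : wC ≤ WC) (hwO : 0 ≤ wO) (hO : wO ≤ WO) (h𝔞0 : 0 ≤ 𝔞) (h𝔞 : 𝔞 ≤ α)
    (hfC : Real.sqrt fC ≤ ψ) (hfS : fS ≤ φS) (hfT : fT ≤ φT) (hfO : fO ≤ φO) (ho : 0 ≤ o) :
    wT ^ 2 + 2 * wT * o + (wS + wC + 𝔞 + Real.sqrt fC) ^ 2 + (wO + wC + 𝔞 + Real.sqrt fC) ^ 2 + fS + fT + fO ≤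
      WT ^ 2 + 2 * WT * o + (WS + WC + α + ψ) ^ 2 + (WO + WC + α + ψ) ^ 2 + φS + φT + φO := by
  have h1 : wT ^ 2 ≤ WT ^ 2 := pow_le_pow_left₀ hwT hT 2
  have h2 : 2 * wT * o ≤ 2 * WT * o := by nlinarith
  have h3 := sq_window_amplitudeW_le hwS hS hwC hC h𝔞0 h𝔞 hfC
  have h4 := sq_window_amplitudeW_le hwO hO hwC hC h𝔞0 h𝔞 hfC
  linarith

/-- **The next off-cone amplitude against certified amplitudes** (`…LedgerFeedChain.sqrt_offCone_next_le` shape):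
`w_O + w_C + 𝔞 + √f_C + √f_O ≤ W_O + W_C + α + ψ + ψ_O`. [folklore] -/
theorem offConeNextW_le {wO wC WO WC 𝔞 α fC fO ψ ψO : ℝ} (hO : wO ≤ WO) (hC : wC ≤ WC) (h𝔞 : 𝔞 ≤ α)
    (hfC : Real.sqrt fC ≤ ψ) (hfO : Real.sqrt fO ≤ ψO) :
    wO + wC + 𝔞 + Real.sqrt fC + Real.sqrt fO ≤ WO + WC + α + ψ + ψO := by
  linarith

end Summit.AnomalousDissipation.AnomalousDissipation.Theorems.SawtoothPulseCascade.K1Window
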